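/-
COR-CM (cells pub-hodgecm / pub-hodgecm2, stage 2 of the Hodge ladder) — TRANSPOSITION SURGE, item (vi) sub-binder S2, TEAM hComp:
the ELSE-BRANCH of b25's total honest datum `Model.honestP5Of` — the punctured projective plane `ℙ²_F ∖ {[0:0:1]}`
(`Model.puncturedPlane`, `HComp/HonestP5Of.lean`) — has the Noncompact-Case shape [Liu2021] §4.2 prescribes AS A KERNEL FACT:
it is smooth of relative dimension 2, NOT proper (hence not projective) over `F`, and sits in `ℙ²_F` by an open immersion over `F`
whose complement is ONE point.  Seat prover-pub-hodgecm2-pin-1-g3-0 (pin-1 gen 3, owner of record of `hComp`).  THEOREMS ONLY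
(no definition, no instance, no notation, no named fact); nothing asserted; nothing landed is edited or restated.
FRAMING: HC_CM is NOT proved; nothing here discharges any COR-CM binder.
-/
import Summits.HodgeConjecture.CorCM.B01.Transposition.HComp.HonestP5Of
import Literature.AlgebraicGeometry.Motives.VarietiesProjectiveSpaceProofs
import Literature.AlgebraicGeometry.Motives.VarietiesProperProofs
import Mathlib.RingTheory.MvPolynomial.Ideal
import Mathlib.AlgebraicGeometry.Morphisms.Proper
import HarnessLib

/-!
# The punctured plane `ℙ²_F ∖ {[0:0:1]} = D₊(x₀) ∪ D₊(x₁)`: smooth, not proper, one boundary point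

hcomp-lead's RULING F1′ / hcomp-ref R-5 (HOME/INBOX l.5453, l.5467) placed, in the never-read `[F:ℚ] = 2` branch of the total
record functor `Model.recordFunctorOf` (`HComp/HonestP5Of.lean`), the constant system at the punctured projective plane
`Model.puncturedPlane F = (D₊(x₀) ⊔ D₊(x₁)) ⊂ Proj F[x₀,x₁,x₂]`, so that the consumer's posited carrier type
`Sec42Data (honestP5Of h F ι₁ V Φ) iso` «stays inhabitable IN PRINCIPLE» at an imaginary quadratic `F` ([Liu2021] §4.2
l. 2055–2064, Noncompact Case `d = 1`, `n = 3`: `Sh(𝕍)_K` smooth, NOT projective; `X_K = S̃h(𝕍)_K` smooth projective with finitely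
many boundary points).  This file turns «in principle» into theorems:

* §1 (algebra in `k[x₀,x₁,x₂]`, any field `k`): `coeff_aeval_zeroZeroX`, `ker_aeval_zeroZeroX` — `(x₀, x₁)` is the kernel of
  `x₀, x₁ ↦ 0, x₂ ↦ X`, hence prime (`isPrime_span_X01`); `mem_span_of_isHomogeneous`, `eq_span_X01_of_isPrime` — a homogeneous prime
  containing `x₀, x₁` but not `x₂` IS `(x₀, x₁)` (so `Proj k[x₀,x₁,x₂] ∖ (D₊(x₀) ∪ D₊(x₁))` is the single point `[0:0:1]`);
* §2 (b25's `Model.puncturedPlane F`): `smooth_puncturedPlane` (open in the smooth `ℙ²_F`, tree `isSmoothProjective_projectiveSpace_holds`);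
  `not_isProper_puncturedPlane` (a proper open immersion into the separated `ℙ²_F → Spec F` would have closed, hence — `ℙ²_F` being
  irreducible, tree `ProjectiveSpace.geometricallyIrreducible_projToSpec` + generic point — empty or total image; it contains the
  generic point and misses `[0:0:1]`); `not_isProjectiveOver_puncturedPlane` (tree `IsProjectiveOver.isProper`);
  `exists_openImmersion_puncturedPlane` — an open immersion `puncturedPlane F ⟶ projectiveSpace 2 F` OVER `F` whose image misses at
  most one point; and `smooth_projectiveSpace_two`, `isProjectiveOver_projectiveSpace_two` for the compactification `ℙ²_F`.

Consumer: `HComp/HonestP5OfNonVacuityAll.lean` (pin-1), which builds from these the §4.2 datum `Sec42Data (honestP5Of h F ι₁ V Φ) iso`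
at `[F:ℚ] = 2` and hence inhabits the Π-binders `C`, `R` of every hComp END display at ALL indices.  T5: n/a (no Prop-valued
hypothesis binders).  HC_CM is NOT proved.

References: [Liu2021] Y. Liu, arXiv:2102.11518, §4.2 l. 2053–2064, App. C l. 4656; R. Hartshorne, *Algebraic Geometry* (1977) II
Prop. 2.5, Ex. 2.9, Ex. 3.15, II §4 (Cor. 4.8, Thm. 4.9), III Ex. 10.0.1; Stacks Tags 01W0/01W6 (image of a proper morphism is closed), 0366.
-/

noncomputable section

open CategoryTheory CategoryTheory.Limits AlgebraicGeometry MvPolynomial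
open Literature.AlgebraicGeometry.Motives

universe u

namespace Summit.HodgeConjecture.CorCM.HComp.PuncturedPlane

/-! ## §1  `(x₀, x₁) ⊂ k[x₀,x₁,x₂]`: a prime; the only relevant homogeneous prime containing it -/

section Algebra

variable (k : Type u) [Field k]

/-- A monomial exponent on `Fin 3` vanishing at `0` and `1` is a power of `x₂`. [folklore] -/
theorem eq_single_two {m : Fin 3 →₀ ℕ} (h0 : m 0 = 0) (h1 : m 1 = 0) : m = Finsupp.single 2 (m 2) := by
  ext i
  fin_cases i <;> simp [h0, h1]

/-- The evaluation `k[x₀,x₁,x₂] → k[X]`, `x₀, x₁ ↦ 0`, `x₂ ↦ X`, reads off the coefficients of the pure powers of `x₂`. [folklore] -/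
theorem coeff_aeval_zeroZeroX (p : MvPolynomial (Fin 3) k) (d : ℕ) :
    ((aeval ![0, 0, Polynomial.X] : MvPolynomial (Fin 3) k →ₐ[k] Polynomial k) p).coeff d = coeff (Finsupp.single 2 d) p := by
  classical
  induction p using MvPolynomial.induction_on' with
  | monomial u a =>
    rw [aeval_monomial, coeff_monomial, Finsupp.prod_fintype _ _ (fun i => pow_zero _), Fin.prod_univ_three]
    simp only [Matrix.cons_val_zero, Matrix.cons_val_one, Matrix.cons_val, Polynomial.algebraMap_eq,
      Polynomial.coeff_C_mul]
    by_cases h0 : u 0 = 0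
    · by_cases h1 : u 1 = 0
      · simp only [h0, h1, pow_zero, one_mul, Polynomial.coeff_X_pow]
        have hiff : d = u 2 ↔ u = Finsupp.single (2 : Fin 3) d :=
          ⟨fun h => by rw [h]; exact eq_single_two h0 h1, fun h => by rw [h]; simp⟩
        by_cases hd : d = u 2
        · rw [if_pos hd, if_pos (hiff.mp hd), mul_one]
        · rw [if_neg hd, if_neg (fun h => hd (hiff.mpr h)), mul_zero]
      · rw [zero_pow h1, mul_zero, zero_mul, Polynomial.coeff_zero, mul_zero, if_neg]
        intro h
        apply h1
        rw [h]
        simp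
    · rw [zero_pow h0, zero_mul, zero_mul, Polynomial.coeff_zero, mul_zero, if_neg]
      intro h
      apply h0
      rw [h]
      simp
  | add p q hp hq => rw [map_add, Polynomial.coeff_add, coeff_add, hp, hq]

/-- **`ker (x₀, x₁ ↦ 0, x₂ ↦ X) = (x₀, x₁)`** (Mathlib `MvPolynomial.mem_ideal_span_X_image`). [folklore] -/
theorem ker_aeval_zeroZeroX :
    RingHom.ker (aeval ![0, 0, Polynomial.X] : MvPolynomial (Fin 3) k →ₐ[k] Polynomial k) =
      Ideal.span ((X : Fin 3 → MvPolynomial (Fin 3) k) '' {0, 1}) := by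
  classical
  apply le_antisymm
  · intro p hp
    rw [RingHom.mem_ker] at hp
    rw [mem_ideal_span_X_image]
    intro m hm
    by_contra h
    push Not at h
    have h0 : m 0 = 0 := h 0 (by simp)
    have h1 : m 1 = 0 := h 1 (by simp)
    have hc := coeff_aeval_zeroZeroX k p (m 2)
    rw [hp, Polynomial.coeff_zero, ← eq_single_two h0 h1] at hc
    exact (mem_support_iff.mp hm) hc.symm
  · rw [Ideal.span_le]
    rintro _ ⟨i, hi, rfl⟩
    simp only [Set.mem_insert_iff, Set.mem_singleton_iff] at hi
    rcases hi with rfl | rfl <;> simp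

/-- `(x₀, x₁) ⊂ k[x₀,x₁,x₂]` is prime (a kernel into the domain `k[X]`). [folklore] -/
theorem isPrime_span_X01 : (Ideal.span ((X : Fin 3 → MvPolynomial (Fin 3) k) '' {0, 1})).IsPrime := by
  rw [← ker_aeval_zeroZeroX k]
  exact RingHom.ker_isPrime _

/-- `x₂ ∉ (x₀, x₁)`. [folklore] -/
theorem X_two_not_mem_span_X01 : (X 2 : MvPolynomial (Fin 3) k) ∉ Ideal.span ((X : Fin 3 → MvPolynomial (Fin 3) k) '' {0, 1}) := by
  classical
  rw [mem_ideal_span_X_image]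
  intro h
  obtain ⟨i, hi, hne⟩ := h (Finsupp.single 2 1) (by simp [support_X])
  simp only [Set.mem_insert_iff, Set.mem_singleton_iff] at hi
  rcases hi with rfl | rfl <;> simp at hne

/-- A HOMOGENEOUS element of a prime `q ∋ x₀, x₁` with `x₂ ∉ q` lies in `(x₀, x₁)`: subtracting its `x₂^i`-term leaves a polynomial all
of whose monomials involve `x₀` or `x₁`; a non-zero `x₂^i`-term would put `x₂` (or `1`) in `q`. [folklore] -/
theorem mem_span_of_isHomogeneous {q : Ideal (MvPolynomial (Fin 3) k)} (hq : q.IsPrime)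
    (hle : Ideal.span ((X : Fin 3 → MvPolynomial (Fin 3) k) '' {0, 1}) ≤ q) (hX2 : (X 2 : MvPolynomial (Fin 3) k) ∉ q)
    {i : ℕ} {p : MvPolynomial (Fin 3) k} (hp : p.IsHomogeneous i) (hpq : p ∈ q) :
    p ∈ Ideal.span ((X : Fin 3 → MvPolynomial (Fin 3) k) '' {0, 1}) := by
  classical
  set c := coeff (Finsupp.single 2 i) p with hc_def
  have hg : p - monomial (Finsupp.single 2 i) c ∈ Ideal.span ((X : Fin 3 → MvPolynomial (Fin 3) k) '' {0, 1}) := by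
    rw [mem_ideal_span_X_image]
    intro m hm
    have hm' : coeff m (p - monomial (Finsupp.single 2 i) c) ≠ 0 := mem_support_iff.mp hm
    rw [coeff_sub, coeff_monomial] at hm'
    by_contra h
    push Not at h
    have h0 : m 0 = 0 := h 0 (by simp)
    have h1 : m 1 = 0 := h 1 (by simp)
    by_cases hms : Finsupp.single 2 i = m
    · rw [if_pos hms, ← hms] at hm'
      exact hm' (sub_self _)
    · rw [if_neg hms, sub_zero] at hm'
      have hdeg : Finsupp.weight (1 : Fin 3 → ℕ) m = i := hp hm'
      apply hms
      rw [eq_single_two h0 h1]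
      congr 1
      rw [Finsupp.weight_apply, Finsupp.sum_fintype _ _ (fun _ => by simp), Fin.sum_univ_three] at hdeg
      simpa [h0, h1] using hdeg.symm
  by_cases hc : c = 0
  · simpa [hc] using hg
  · exfalso
    have hmono : monomial (Finsupp.single 2 i) c ∈ q := by
      have := Ideal.sub_mem _ hpq (hle hg)
      simpa using this
    have hX2i : (X 2 : MvPolynomial (Fin 3) k) ^ i ∈ q := by
      have heq : C c⁻¹ * monomial (Finsupp.single (2 : Fin 3) i) c = (X 2 : MvPolynomial (Fin 3) k) ^ i := by
        rw [C_mul_monomial, inv_mul_cancel₀ hc, X_pow_eq_monomial]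
      rw [← heq]
      exact Ideal.mul_mem_left _ (C c⁻¹) hmono
    rcases Nat.eq_zero_or_pos i with rfl | hi
    · rw [pow_zero] at hX2i
      exact hq.ne_top ((Ideal.eq_top_iff_one _).mpr hX2i)
    · exact hX2 (hq.mem_of_pow_mem i hX2i)

/-- **A prime `q ⊂ k[x₀,x₁,x₂]` stable under taking homogeneous components, containing `x₀, x₁` but not `x₂`, IS `(x₀, x₁)`** — the
points of `Proj k[x₀,x₁,x₂]` outside `D₊(x₀) ∪ D₊(x₁)` are all the vertex `[0:0:1]`. [folklore] -/
theorem eq_span_X01_of_isPrime {q : Ideal (MvPolynomial (Fin 3) k)} (hq : q.IsPrime)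
    (hhom : ∀ f ∈ q, ∀ i : ℕ, homogeneousComponent i f ∈ q) (h0 : (X 0 : MvPolynomial (Fin 3) k) ∈ q)
    (h1 : (X 1 : MvPolynomial (Fin 3) k) ∈ q) (hX2 : (X 2 : MvPolynomial (Fin 3) k) ∉ q) :
    q = Ideal.span ((X : Fin 3 → MvPolynomial (Fin 3) k) '' {0, 1}) := by
  classical
  have hle : Ideal.span ((X : Fin 3 → MvPolynomial (Fin 3) k) '' {0, 1}) ≤ q := by
    rw [Ideal.span_le]
    rintro _ ⟨i, hi, rfl⟩
    simp only [Set.mem_insert_iff, Set.mem_singleton_iff] at hi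
    rcases hi with rfl | rfl
    · exact h0
    · exact h1
  refine le_antisymm (fun f hf => ?_) hle
  rw [← sum_homogeneousComponent f]
  exact Ideal.sum_mem _ fun i _ =>
    mem_span_of_isHomogeneous k hq hle hX2 (homogeneousComponent_isHomogeneous i f) (hhom f hf i)

end Algebra

/-! ## §2  b25's `Model.puncturedPlane F` and its compactification `ℙ²_F` -/

section Punctured

open Summit.HodgeConjecture.CorCM.Model NumberField

variable (F : CMField)

/-- `ℙ²_F` is smooth of relative dimension `2` over `F` (tree `isSmoothProjective_projectiveSpace_holds`). [folklore] -/
theorem smooth_projectiveSpace_two : SmoothOfRelativeDimension 2 (projectiveSpace 2 (F : Type)).hom :=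
  (isSmoothProjective_projectiveSpace_holds (F : Type) 2).smoothOfRelativeDimension

/-- `ℙ²_F` is projective over `F` (tree `isSmoothProjective_projectiveSpace_holds`). [folklore] -/
theorem isProjectiveOver_projectiveSpace_two : IsProjectiveOver (projectiveSpace 2 (F : Type)) :=
  (isSmoothProjective_projectiveSpace_holds (F : Type) 2).isProjectiveOver

/-- **The punctured plane is smooth of relative dimension `2` over `F`**: its structure morphism is (by `rfl`) the open immersion
`(D₊(x₀) ∪ D₊(x₁)).ι` followed by `ℙ²_F → Spec F`, smooth of relative dimension 2 (tree `ProjectiveSpace.smoothOfRelativeDimension_projToSpec`).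
[folklore] -/
theorem smooth_puncturedPlane : SmoothOfRelativeDimension 2 (puncturedPlane F).hom := by
  letI := MvPolynomial.gradedAlgebra (σ := Fin 3) (R := (F : Type))
  haveI : SmoothOfRelativeDimension 2 (ProjBaseChange.projToSpec (Fin 3) (F : Type)) :=
    ProjectiveSpace.smoothOfRelativeDimension_projToSpec 2 (F : Type)
  have h : SmoothOfRelativeDimension (0 + 2)
      ((Proj.basicOpen (homogeneousSubmodule (Fin 3) (F : Type)) (X 0) ⊔
          Proj.basicOpen (homogeneousSubmodule (Fin 3) (F : Type)) (X 1)).ι ≫ ProjBaseChange.projToSpec (Fin 3) (F : Type)) :=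
    inferInstance
  exact h

/-- **The punctured plane is NOT proper over `F`.**  If `D₊(x₀) ∪ D₊(x₁) ↪ ℙ²_F → Spec F` were proper, the open immersion into the
separated `ℙ²_F → Spec F` would be proper (Mathlib `IsProper.of_comp`), hence a closed map with closed image; but `ℙ²_F` is irreducible
(tree `ProjectiveSpace.geometricallyIrreducible_projToSpec`), so a clopen subset is empty or everything, while `D₊(x₀) ∪ D₊(x₁)` contains
the generic point and misses the vertex `(x₀, x₁)` (a relevant homogeneous prime, §1). [folklore] -/
theorem not_isProper_puncturedPlane : ¬ IsProper (puncturedPlane F).hom := by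
  classical
  letI := MvPolynomial.gradedAlgebra (σ := Fin 3) (R := (F : Type))
  intro h
  -- the open `D₊(x₀) ∪ D₊(x₁)` of `Proj F[x₀,x₁,x₂]`
  let U : Scheme.Opens (Proj (homogeneousSubmodule (Fin 3) (F : Type))) :=
    Proj.basicOpen (homogeneousSubmodule (Fin 3) (F : Type)) (X 0) ⊔ Proj.basicOpen (homogeneousSubmodule (Fin 3) (F : Type)) (X 1)
  have hP : IsProper (U.ι ≫ ProjBaseChange.projToSpec (Fin 3) (F : Type)) := h
  have hUι : IsProper U.ι := IsProper.of_comp U.ι (ProjBaseChange.projToSpec (Fin 3) (F : Type))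
  have hcl : IsClosed (U : Set (Proj (homogeneousSubmodule (Fin 3) (F : Type)))) := by
    rw [← Scheme.Opens.range_ι U]
    exact U.ι.isClosedMap.isClosed_range
  -- `ℙ²_F` is irreducible
  haveI := ProjectiveSpace.geometricallyIrreducible_projToSpec 2 (F : Type)
  haveI : IrreducibleSpace ↥(Proj (homogeneousSubmodule (Fin 3) (F : Type))) :=
    GeometricallyIrreducible.irreducibleSpace_of_subsingleton (ProjBaseChange.projToSpec (Fin 3) (F : Type))
  rcases isClopen_iff.mp ⟨hcl, U.isOpen⟩ with hU | hU
  · -- the generic point lies in `D₊(x₀)`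
    have hη : ProjectiveSpace.genericPoint 2 (F : Type) ∈ U :=
      TopologicalSpace.Opens.mem_sup.mpr (Or.inl (ProjectiveSpace.genericPoint_mem_basicOpen 2 (F : Type) 0))
    rw [← SetLike.mem_coe, hU] at hη
    exact hη
  · -- the vertex `(x₀, x₁)` is a point of `Proj` outside `D₊(x₀) ∪ D₊(x₁)`
    have hXmem : ∀ s : Fin 3, (X s : MvPolynomial (Fin 3) (F : Type)) ∈ homogeneousSubmodule (Fin 3) (F : Type) 1 :=
      fun s => (mem_homogeneousSubmodule 1 (X s)).mpr (isHomogeneous_X _ s)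
    let v : Proj (homogeneousSubmodule (Fin 3) (F : Type)) :=
      { asHomogeneousIdeal := ⟨Ideal.span ((X : Fin 3 → MvPolynomial (Fin 3) (F : Type)) '' {0, 1}),
          Ideal.homogeneous_span _ _ (by
            rintro _ ⟨i, -, rfl⟩
            exact ⟨1, hXmem i⟩)⟩
        isPrime := isPrime_span_X01 (F : Type)
        not_irrelevant_le := fun hle =>
          X_two_not_mem_span_X01 (F : Type) (hle (HomogeneousIdeal.mem_irrelevant_of_mem _ zero_lt_one (hXmem 2))) }
    have hv : v ∉ U := by
      rw [TopologicalSpace.Opens.mem_sup, Proj.mem_basicOpen, Proj.mem_basicOpen, not_or, not_not, not_not]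
      exact ⟨Ideal.subset_span ⟨0, by simp, rfl⟩, Ideal.subset_span ⟨1, by simp, rfl⟩⟩
    rw [← SetLike.mem_coe, hU] at hv
    exact hv (Set.mem_univ _)

/-- **The punctured plane is NOT projective over `F`** (projective ⇒ proper, tree `IsProjectiveOver.isProper`). [folklore] -/
theorem not_isProjectiveOver_puncturedPlane : ¬ IsProjectiveOver (puncturedPlane F) :=
  fun h => not_isProper_puncturedPlane F h.isProper

/-- **`ℙ²_F ∖ {[0:0:1]} ↪ ℙ²_F` over `F`, with ONE boundary point**: there is a morphism `puncturedPlane F ⟶ projectiveSpace 2 F` of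
`F`-schemes whose underlying map is an open immersion and whose image has a subsingleton complement (every point of
`Proj F[x₀,x₁,x₂]` outside `D₊(x₀) ∪ D₊(x₁)` is the relevant homogeneous prime `(x₀, x₁)`, §1). [folklore] -/
theorem exists_openImmersion_puncturedPlane :
    ∃ ι : puncturedPlane F ⟶ projectiveSpace 2 (F : Type), IsOpenImmersion ι.left ∧ ((Set.range ι.left)ᶜ).Subsingleton := by
  classical
  letI := MvPolynomial.gradedAlgebra (σ := Fin 3) (R := (F : Type))
  let U : Scheme.Opens (Proj (homogeneousSubmodule (Fin 3) (F : Type))) :=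
    Proj.basicOpen (homogeneousSubmodule (Fin 3) (F : Type)) (X 0) ⊔ Proj.basicOpen (homogeneousSubmodule (Fin 3) (F : Type)) (X 1)
  refine ⟨Over.homMk U.ι rfl, (inferInstance : IsOpenImmersion U.ι), ?_⟩
  have hrange : Set.range (Over.homMk U.ι rfl : puncturedPlane F ⟶ projectiveSpace 2 (F : Type)).left =
      (U : Set (Proj (homogeneousSubmodule (Fin 3) (F : Type)))) := Scheme.Opens.range_ι U
  rw [hrange]
  -- two points outside `D₊(x₀) ∪ D₊(x₁)` coincide: both are the prime `(x₀, x₁)`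
  have key : ∀ x : Proj (homogeneousSubmodule (Fin 3) (F : Type)), x ∉ U →
      x.asHomogeneousIdeal.toIdeal = Ideal.span ((X : Fin 3 → MvPolynomial (Fin 3) (F : Type)) '' {0, 1}) := by
    intro x hx
    rw [TopologicalSpace.Opens.mem_sup, Proj.mem_basicOpen, Proj.mem_basicOpen, not_or, not_not, not_not] at hx
    refine eq_span_X01_of_isPrime (F : Type) x.isPrime
      (fun f hf i => MvPolynomial.homogeneousComponent_mem_of_mem x.asHomogeneousIdeal.isHomogeneous hf i) hx.1 hx.2 ?_
    intro h2
    apply x.not_irrelevant_le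
    rw [← toIdeal_le_toIdeal_iff]
    refine (ProjectiveSpace.irrelevant_le_span 2 (F : Type)).trans ?_
    rw [Ideal.span_le]
    rintro _ ⟨j, rfl⟩
    fin_cases j
    · exact hx.1
    · exact hx.2
    · exact h2
  intro x hx y hy
  exact ProjectiveSpectrum.ext (HomogeneousIdeal.ext ((key x hx).trans (key y hy).symm))

end Punctured

end Summit.HodgeConjecture.CorCM.HComp.PuncturedPlane

end
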